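/-
Origin: expansion seat `planner-pub-hodgecm-pv06-g7-0`, handover #3 (CLAIM 2026-08-18T15:03:45Z; HANDOVER #3 2026-08-18T15:14:05Z) md5 27e93431a23c99e47827e7c276c65f96 (188 l.); additive KERNEL leaf (node N29 / seam S4: chain rule along curves for hermiteFun + hasDerivAt_hermiteFun_hypRot: the hyperbolic rotation differentiates POINTWISE to hypSymb; hasDerivAt_binv_hypRot: d/ds (binv F)(hypRot s v) at s=0 equals (binv (printedHyp lamF F))(v)); imports Pv06g7.Ar (`HOME/pub-hodgecm-pv06-g7/lean/Pv06g7/ArchCHyperbolicFlow.lean`, md5 27e93431, 188 lines);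
landed by the gen-8 packager in gate run 31 as `HodgeCM/PerL34/ArchCHyperbolicFlow.lean` (import ^import Pv06g7\.ArchCHyperbolicBargmann[ \t]*$→import HodgeCM.PerL34.ArchCHyperbolicBargmann ×1).
-/
/-
Copyright (c) 2026. Released under the Apache-2.0 license.
-/
import Summits.HodgeConjecture.HodgeCM.PerL34.ArchCHyperbolicBargmann
import Mathlib.Analysis.SpecialFunctions.Trigonometric.DerivHyp

/-!
# The hyperbolic direction IS the Lie derivative of a linear flow (node N29, seam S4) — pointwise chain rule

Origin: expansion seat `planner-pub-hodgecm-pv06-g7-0` (unit `pub-hodgecm-pv06-g7`, DAG-node prover #06 gen 7).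
WIP module `Pv06g7.ArchCHyperbolicFlow`; intended final place `HodgeCM/PerL34/ArchCHyperbolicFlow.lean`.
Imports: this seat's row #2 `Pv06g7.ArchCHyperbolicBargmann` (↦ `HodgeCM.PerL34.ArchCHyperbolicBargmann`, ONE
rewrite) and Mathlib's `DerivHyp` (derivatives of `cosh`, `sinh`).  Additive kernel leaf: asserts nothing, complete
proofs, nothing cited enters as a hypothesis.

## What is proved (KERNEL)

Row #2 identified, under pv05's polynomial Bargmann dictionary `binv` at Folland's scaling `lamF = i/π`, the printed
Fock operator `H = printedHyp lamF` of the hyperbolic element `X₁ = E₀₁ + E₁₀` with the SYMBOL `hypSymb` of the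
vector field `V = −Σ_a (x_a ∂/∂y_a + y_a ∂/∂x_a)`, and expressed `V` through derivatives along coordinate lines.
THIS FILE closes the loop with the honest several-variables chain rule along the flow:

* §1 (generic `ι`, pv05's letters) `hasDerivAt_eval_curve` — for a curve `f : ℝ → (ι → ℂ)` differentiable at `s₀`
  coordinatewise, `d/ds eval (f s) p = Σ_k f'_k · (∂_k p)(f s₀)` (induction on `p`); `hasDerivAt_gauss_curve`;
  `hasDerivAt_hermiteFun_curve : d/ds [p e^{−π|·|²}](g s) = Σ_k g'_k · [(∂̂_k p) e^{−π|·|²}](g s₀)` (`opDel` =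
  pv05's symbol of `∂/∂x_k`, [Fo89 (1.81)]).
* §2 **`hasDerivAt_hermiteFun_hypRot`**: for every symbol `p` and point `v ∈ ℝ³ × ℝ³`,
  `HasDerivAt (s ↦ [p e^{−π|·|²}](hypRot s v)) ([(hypSymb p) e^{−π|·|²}](v)) 0` — the symbol `hypSymb` of row #2
  IS the Lie derivative at `s = 0` of the hyperbolic rotation `hypRot s (x, y) = (x cosh s − y sinh s,
  y cosh s − x sinh s)` acting on the Hermite span by composition.
* §3 **`hasDerivAt_binv_hypRot`** (rows #2 + #3 composed): for every Fock polynomial `F ∈ ℂ[z_a, w_a]`,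
  `d/ds|₀ (B⁻¹F)(hypRot s v) = (B⁻¹(H F))(v)`, `H = printedHyp lamF` — i.e. ON GENUINE FUNCTIONS, POINTWISE, the
  printed Fock operator of `X₁` is the derivative of the LINEAR flow `Φ ↦ Φ ∘ hypRot s` transported by pv05's
  kernel dictionary.  (The 𝒮(ℝ⁶)-topology version of "`s ↦ Φ ∘ hypRot s` is differentiable" is pv14-g6's
  `SchwartzLinearFlowDeriv` class, run 31; by uniqueness of limits its derivative evaluated at `v` is the number
  computed here.  The identification of the CONSTRUCTED `ω(exp sX₁)` with this flow is a property of the model —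
  pv11-g9 ENDSTATE-S4-SPEC §3 — not proved and not assumed here.)

Labels.  KERNEL: everything below (Mathlib calculus + pv05-g5's `FockHermite` + rows #1–#2).  PRINT: none used.
PerL / QW8 / 2001 texts NOT cited.
-/

set_option autoImplicit false

noncomputable section

namespace HodgeCM
namespace PerL34
namespace Fock
namespace PrintDict

open MvPolynomial Complex
open scoped BigOperators Real
open HodgeCM.PerL34.Fock.Hermite

/-! ## §1  Chain rules along curves (generic index type) -/

section Curve

variable {ι : Type*} [Fintype ι] [DecidableEq ι]

/-- **Chain rule for polynomial evaluation along a curve** `f : ℝ → (ι → ℂ)` differentiable coordinatewise at `s₀`: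
`d/ds eval (f s) p |_{s₀} = Σ_k f'_k · eval (f s₀) (∂_k p)` (KERNEL, induction on `p`). -/
theorem hasDerivAt_eval_curve (f : ℝ → ι → ℂ) (f' : ι → ℂ) (s₀ : ℝ)
    (hf : ∀ k, HasDerivAt (fun s => f s k) (f' k) s₀) (p : MvPolynomial ι ℂ) :
    HasDerivAt (fun s => eval (f s) p) (∑ k, f' k * eval (f s₀) (pderiv k p)) s₀ := by
  induction p using MvPolynomial.induction_on with
  | C a =>
      have e : (∑ k, f' k * eval (f s₀) (pderiv k (C a : MvPolynomial ι ℂ))) = 0 := by simp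
      rw [e]
      simp only [eval_C]
      exact hasDerivAt_const s₀ a
  | add p q hp hq =>
      have e : (∑ k, f' k * eval (f s₀) (pderiv k (p + q))) =
          (∑ k, f' k * eval (f s₀) (pderiv k p)) + ∑ k, f' k * eval (f s₀) (pderiv k q) := by
        simp only [map_add, mul_add, Finset.sum_add_distrib]
      rw [e]
      simp only [map_add]
      exact hp.add hq
  | mul_X p k hp =>
      have h := hp.mul (hf k)
      have e1 : (fun s => eval (f s) (p * X k)) = fun s => eval (f s) p * f s k := by
        funext s
        rw [map_mul, eval_X]
      have e2 : (∑ j, f' j * eval (f s₀) (pderiv j (p * X k))) =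
          (∑ j, f' j * eval (f s₀) (pderiv j p)) * f s₀ k + eval (f s₀) p * f' k := by
        have hd : ∀ j, f' j * eval (f s₀) (pderiv j (p * X k)) =
            f' j * eval (f s₀) (pderiv j p) * f s₀ k + (if j = k then eval (f s₀) p * f' k else 0) := by
          intro j
          rw [pderiv_mul, map_add, map_mul, map_mul, eval_X]
          by_cases hj : j = k
          · subst hj
            rw [pderiv_X_self, map_one, if_pos rfl]
            ring
          · rw [pderiv_X_of_ne (Ne.symm hj), map_zero, if_neg hj]
            ring
        simp_rw [hd]
        rw [Finset.sum_add_distrib, Finset.sum_ite_eq' Finset.univ k, if_pos (Finset.mem_univ k),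
          Finset.sum_mul]
      rw [e1, e2]
      exact h

omit [DecidableEq ι] in
/-- The Gaussian `e^{−π|g(s)|²}` along a real curve differentiable coordinatewise at `s₀` (KERNEL). -/
theorem hasDerivAt_gauss_curve (g : ℝ → ι → ℝ) (g' : ι → ℝ) (s₀ : ℝ)
    (hg : ∀ k, HasDerivAt (fun s => g s k) (g' k) s₀) :
    HasDerivAt (fun s => gauss (g s))
      (gauss (g s₀) * (-(π : ℂ) * ∑ k, 2 * ((g s₀ k : ℂ)) * (g' k : ℂ))) s₀ := by
  have hq : HasDerivAt (fun s => ∑ k, ((g s k : ℝ) : ℂ) ^ 2) (∑ k, 2 * ((g s₀ k : ℂ)) * (g' k : ℂ)) s₀ := by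
    refine HasDerivAt.fun_sum (u := Finset.univ) (A := fun k s => ((g s k : ℝ) : ℂ) ^ 2)
      (A' := fun k => 2 * ((g s₀ k : ℂ)) * (g' k : ℂ)) (x := s₀) fun k _ => ?_
    have h1 := ((hg k).ofReal_comp).pow 2
    refine h1.congr_deriv ?_
    simp only [Nat.cast_ofNat, Nat.add_one_sub_one, pow_one]
  exact (hq.const_mul (-(π : ℂ))).cexp

/-- **Chain rule for the Hermite-span functions** `[p e^{−π|·|²}]` along a real curve:
`d/ds [p e^{−π|·|²}](g s)|_{s₀} = Σ_k g'_k · [(∂̂_k p) e^{−π|·|²}](g s₀)`, `∂̂_k = opDel k` pv05's symbol of `∂/∂x_k`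
(KERNEL). -/
theorem hasDerivAt_hermiteFun_curve (g : ℝ → ι → ℝ) (g' : ι → ℝ) (s₀ : ℝ)
    (hg : ∀ k, HasDerivAt (fun s => g s k) (g' k) s₀) (p : MvPolynomial ι ℂ) :
    HasDerivAt (fun s => hermiteFun p (g s))
      (∑ k, (g' k : ℂ) * hermiteFun (opDel k p) (g s₀)) s₀ := by
  have he := hasDerivAt_eval_curve (fun s k => ((g s k : ℝ) : ℂ)) (fun k => (g' k : ℂ)) s₀
    (fun k => (hg k).ofReal_comp) p
  have h := he.mul (hasDerivAt_gauss_curve g g' s₀ hg)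
  unfold hermiteFun
  refine h.congr_deriv ?_
  simp only [opDel_apply, map_sub, smul_eval, map_mul, eval_X, Finset.sum_mul, Finset.mul_sum]
  rw [← Finset.sum_add_distrib]
  refine Finset.sum_congr rfl fun k _ => ?_
  ring

end Curve

/-! ## §2  The hyperbolic rotation differentiates to `hypSymb` -/

/-- The velocity field of the hyperbolic rotation: `d/ds hypRot s v |₀ = hypVel v = (−y, −x)`. -/
def hypVel (v : MixedVar → ℝ) : MixedVar → ℝ
  | Sum.inl a => -v (Sum.inr a)
  | Sum.inr a => -v (Sum.inl a)

/-- (Ported verbatim from the HodgeCMPerL package; no docstring in the source.) -/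
theorem hasDerivAt_hypRot_hypVel (v : MixedVar → ℝ) (k : MixedVar) :
    HasDerivAt (fun s : ℝ => hypRot s v k) (hypVel v k) 0 := by
  cases k with
  | inl a => exact hasDerivAt_hypRot v (Sum.inl a)
  | inr a => exact hasDerivAt_hypRot v (Sum.inr a)

/-- `hypSymb` on genuine functions, in closed form: `[(V̂p) e^{−π|·|²}](v) = −Σ_a ( x_a [(∂̂_{y_a}p)e^{−π|·|²}](v) +
y_a [(∂̂_{x_a}p) e^{−π|·|²}](v) )`. -/
theorem hermiteFun_hypSymb_eq (p : MvPolynomial MixedVar ℂ) (v : MixedVar → ℝ) :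
    hermiteFun (hypSymb p) v =
      -∑ a : Fin 3, ((v (Sum.inl a) : ℂ) * hermiteFun (opDel (Sum.inr a) p) v +
        (v (Sum.inr a) : ℂ) * hermiteFun (opDel (Sum.inl a) p) v) := by
  rw [hypSymb, LinearMap.neg_apply, hermiteFun_neg', LinearMap.sum_apply, hermiteFun_sum]
  refine congrArg Neg.neg (Finset.sum_congr rfl fun a _ => ?_)
  rw [LinearMap.add_apply, hermiteFun_add, Module.End.mul_apply, Module.End.mul_apply, hermiteFun_opX,
    hermiteFun_opX]

/-- **The hyperbolic rotation differentiates to `hypSymb` (KERNEL)**: for every symbol `p` and every point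
`v ∈ ℝ³ × ℝ³`, `d/ds [p e^{−π|·|²}](hypRot s v) |_{s=0} = [(hypSymb p) e^{−π|·|²}](v)`. -/
theorem hasDerivAt_hermiteFun_hypRot (p : MvPolynomial MixedVar ℂ) (v : MixedVar → ℝ) :
    HasDerivAt (fun s : ℝ => hermiteFun p (hypRot s v)) (hermiteFun (hypSymb p) v) 0 := by
  have h := hasDerivAt_hermiteFun_curve (fun s => hypRot s v) (hypVel v) 0 (hasDerivAt_hypRot_hypVel v) p
  refine h.congr_deriv ?_
  rw [hypRot_zero, hermiteFun_hypSymb_eq, Fintype.sum_sum_type, ← Finset.sum_add_distrib,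
    ← Finset.sum_neg_distrib]
  refine Finset.sum_congr rfl fun a _ => ?_
  simp only [hypVel, ofReal_neg]
  ring

/-! ## §3  Composition with the Bargmann dictionary -/

/-- **`d/ds|₀ (B⁻¹F)(hypRot s v) = (B⁻¹(H F))(v)` (KERNEL; rows #2 + #3)**: on genuine functions, pointwise, the
printed Fock operator `H = printedHyp lamF` of the hyperbolic element `X₁` is the derivative of the LINEAR flow
`Φ ↦ Φ ∘ hypRot s`, transported by pv05's polynomial inverse Bargmann transform `binv`. -/
theorem hasDerivAt_binv_hypRot (F : MixedModel) (v : MixedVar → ℝ) :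
    HasDerivAt (fun s : ℝ => hermiteFun (binv F) (hypRot s v))
      (hermiteFun (binv (printedHyp lamF F)) v) 0 := by
  rw [binv_printedHyp]
  exact hasDerivAt_hermiteFun_hypRot (binv F) v

end PrintDict
end Fock
end PerL34
end HodgeCM

end
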